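import Literature.NumberTheory.Sieve.BombieriAsymptoticSieveSmoothPart
import Mathlib.NumberTheory.ArithmeticFunction.Misc
import Mathlib.Data.Finset.NatDivisors
import Mathlib.Analysis.SpecialFunctions.Pow.Real
import HarnessLib

/-!
# Landreau's inequality: the divisor function is dominated by a short divisor sum

Topic `Literature/NumberTheory/Sieve`. Landreau's elementary device (B. Landreau, *A new proof of
a theorem of van der Corput*, Bull. London Math. Soc. 21 (1989), 366–368) bounds the divisor
function `τ(n)` by a "Type I" sum over the SMALL divisors of `n`:
`τ(n) ≪_ε ∑_{d ∣ n, d ≤ n^ε} τ(d)^{O_ε(1)}`. We vendor it in the form and with the proof printed in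
Tao–Teräväinen, *The Hardy–Littlewood–Chowla conjecture in the presence of a Siegel zero*
(J. London Math. Soc. 106 (2022); arXiv:2109.06291), Lemma 3.1 ("Landreau's inequality"), where it
is the tool that converts divisor-type weights into Type I sums (used in their Lemma 5.1, in the
proofs of (5.7)–(5.8), in Lemma 6.1 and in Proposition 6.3). Everything in this file is PROVED.

## What the source prints (arXiv:2109.06291, §2.3 and Lemma 3.1, read on the page)

* §2.3: "If `n` is a natural number and `p` is a prime, we let `n_(p)` denote the largest power of
  `p` dividing `n` … For any threshold `z > 1`, we may therefore factor a natural number `n` as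
  `n = n_(≤z) n_(>z)` where the `z`-smooth and `z`-rough components `n_(≤z)`, `n_(>z)` of `n` are
  defined as `n_(≤z) := ∏_{p ≤ z} n_(p)`, `n_(>z) := ∏_{p > z} n_(p)`"; `ℕ_(≤z)` is the set of
  `z`-smooth numbers.
* Lemma 3.1 (Landreau's inequality). "(i) If `n` is a natural number and `y > z > 1`, then we can
  factor `n = n_(>z) n₁ ⋯ n_m` where `n₁, …, n_m ≤ y` lie in `ℕ_(≤z)` and `0 ≤ m ≤ 1 + log_{y/z} n`.
  Also, `n_(>z)` is the product of at most `log_z n` primes.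
  (ii) If `ε > 0`, then `τ(n) ≪_ε ∑_{d ∣ n : d ≤ n^ε} τ(d)^{O_ε(1)}` for all `n ≥ 1`."
  Proof of (i): "any number in `ℕ_(≤z)` is either [at most] `y`, or contains a factor between `y/z`
  and `y`. Iterating this fact, we can factor `n_(≤z) = n₁ ⋯ n_m` where `n₁, …, n_m ≤ y` and all but
  at most one of the `n₁, …, n_m` are greater than or equal to `y/z`. This gives the bound
  `m ≤ 1 + log_{y/z} n`. Since `n_(>z)` is the product of primes greater than `z`, the total number
  of primes is at most `log_z n`." Proof of (ii): "(i) with `y = n^ε` and `z = n^{ε/2}` …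
  `τ(n) ≪ τ(n₁) ⋯ τ(n_m)` and hence by the pigeonhole principle `τ(n) ≪ τ(d)^m` for `d` equal to
  one of the `n₁, …, n_m`."
  [cite: TaoTeravainen2021, §2.3 and Lemma 3.1] [cite: Landreau1989]

## Contents (namespace `Literature.NumberTheory.Sieve.Landreau`)

* The parts `n_(≤z)`, `n_(>z)` of §2.3 are the tree's `Literature.NumberTheory.Sieve.smoothPart k n`
  (`BombieriAsymptoticSieveSmoothPart.lean`: `∏_{p ∣ n, p < k} p^{v_p(n)}`, with `smoothPart_mul_div`,
  `coprime_smoothPart_div`, `smoothPart_mem_smoothNumbers`, `not_dvd_div_smoothPart`) and its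
  cofactor `n / smoothPart k n`; the threshold is a natural number `k` ("prime factors `< k`",
  matching `Nat.smoothNumbers k`), and for a real threshold `z ≥ 0` one takes `k = ⌊z⌋₊ + 1`
  (`lt_floor_add_one_iff`). Added here: `pow_cardFactors_div_smoothPart_le` (`k^{Ω(n_(>z))} ≤ n`)
  and `cardFactors_div_smoothPart_le` — "`n_(>z)` is the product of at most `log_z n` primes".
* `exists_dvd_lt_le` — the greedy step: a `z`-smooth `N > y` has a divisor in `(y/z, y]`.
* `exists_factorization_smooth` — Lemma 3.1 (i) for a `z`-smooth number, and
  `exists_factorization` — Lemma 3.1 (i) as printed (`m ≤ 1 + log n / log (y/z)`).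
* `card_divisors_le_sum` — Lemma 3.1 (ii) with explicit admissible constants: for `ε > 0`,
  `τ(n) ≤ 2^{2/ε} ∑_{d ∣ n, d ≤ y} τ(d)^M` for every `y ≥ n^ε`, `M = ⌊1 + 2/ε⌋₊`; and the form
  (3.10) used in the source, `card_divisors_le_sum_of_le` (`n ≤ X`, divisors `d ≤ X^ε`).

The divisor function is rendered as `n.divisors.card` (as in the tree files that consume (3.10),
e.g. `Literature/Barriers/Parity/SiegelZeroDichotomyPairHLStepTwo.lean`); `τ(ab) ≤ τ(a)τ(b)` and
`τ(m) ≤ 2^{Ω(m)}` are re-proved as private helpers (the tree has them in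
`VaughanMeanValueDecomposition.lean` / `BombieriAsymptoticSieveLemma11T.lean`, whose import closures
are not wanted here).
-/

open Finset Real
open scoped ArithmeticFunction.Omega

namespace Literature.NumberTheory.Sieve

namespace Landreau

/-! ### The smooth part `n_(≤z)` and its rough cofactor `n_(>z)` (§2.3) -/

/-- For a prime `p` and a real threshold `z ≥ 0`: `p < ⌊z⌋₊ + 1 ↔ p ≤ z` (so `Nat.smoothNumbers
(⌊z⌋₊ + 1)` is the set `ℕ_(≤z)` of `z`-smooth numbers of the source, and `smoothPart (⌊z⌋₊ + 1) n`
is its `n_(≤z)`). [folklore] -/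
theorem lt_floor_add_one_iff {z : ℝ} (hz : 0 ≤ z) (p : ℕ) : p < ⌊z⌋₊ + 1 ↔ (p : ℝ) ≤ z := by
  rw [Nat.lt_add_one_iff]
  exact Nat.le_floor_iff hz

/-- "`n_(>z)` is the product of at most `log_z n` primes", multiplicative form: every prime factor
of the cofactor `n / smoothPart k n` is `≥ k` (`not_dvd_div_smoothPart`), hence
`k^{Ω(n / n_(≤z))} ≤ n` for `n ≠ 0`. [cite: TaoTeravainen2021, Lemma 3.1 (i)] -/
theorem pow_cardFactors_div_smoothPart_le (k : ℕ) {n : ℕ} (hn : n ≠ 0) :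
    k ^ Ω (n / smoothPart k n) ≤ n := by
  have h0 : n / smoothPart k n ≠ 0 := fun h0 => hn (by rw [← smoothPart_mul_div hn k, h0, mul_zero])
  calc k ^ Ω (n / smoothPart k n) ≤ (n / smoothPart k n).primeFactorsList.prod := by
        rw [ArithmeticFunction.cardFactors_apply]
        refine List.pow_card_le_prod _ _ fun p hp => ?_
        have hpp : p.Prime := Nat.prime_of_mem_primeFactorsList hp
        exact not_lt.mp fun hlt =>
          not_dvd_div_smoothPart hpp hlt hn (Nat.dvd_of_mem_primeFactorsList hp)
    _ = n / smoothPart k n := Nat.prod_primeFactorsList h0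
    _ ≤ n := Nat.div_le_self n _

/-- "`n_(>z)` is the product of at most `log_z n` primes": for a real threshold `z > 1` and
`n ≠ 0`, `Ω(n / n_(≤z)) ≤ log n / log z`. [cite: TaoTeravainen2021, Lemma 3.1 (i)] -/
theorem cardFactors_div_smoothPart_le {z : ℝ} (hz : 1 < z) {n : ℕ} (hn : n ≠ 0) :
    (Ω (n / smoothPart (⌊z⌋₊ + 1) n) : ℝ) ≤ Real.log n / Real.log z := by
  have hz0 : 0 < z := by linarith
  have hlogz : 0 < Real.log z := Real.log_pos hz
  set m := Ω (n / smoothPart (⌊z⌋₊ + 1) n)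
  have h1 : ((⌊z⌋₊ + 1 : ℕ) : ℝ) ^ m ≤ n := by
    exact_mod_cast pow_cardFactors_div_smoothPart_le (⌊z⌋₊ + 1) hn
  have h2 : z ^ m ≤ n :=
    (pow_le_pow_left₀ hz0.le (Nat.lt_floor_add_one z).le m).trans (by exact_mod_cast h1)
  have h3 : (m : ℝ) * Real.log z ≤ Real.log n := by
    rw [← Real.log_pow]
    exact Real.log_le_log (pow_pos hz0 m) h2
  rwa [le_div_iff₀ hlogz]

/-! ### The greedy step and Lemma 3.1 (i) -/

/-- The greedy step of the proof of Lemma 3.1 (i): a `z`-smooth number `N > y` (`z > 0`, `y ≥ 1`)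
"contains a factor between `y/z` and `y`" — the largest divisor `f ≤ y` of `N` exceeds `y/z`,
for otherwise `f p ≤ y` for any prime `p ∣ N/f` (all `≤ z`). [cite: TaoTeravainen2021, proof of Lemma 3.1 (i)] -/
theorem exists_dvd_lt_le {y z : ℝ} (hz : 0 < z) (hy : 1 ≤ y) {N : ℕ}
    (hN : N ∈ Nat.smoothNumbers (⌊z⌋₊ + 1)) (hyN : y < N) :
    ∃ f : ℕ, f ∣ N ∧ y / z < f ∧ (f : ℝ) ≤ y := by
  classical
  have hN0 : N ≠ 0 := Nat.ne_zero_of_mem_smoothNumbers hN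
  set S : Finset ℕ := N.divisors.filter fun d => (d : ℝ) ≤ y with hS
  have h1S : 1 ∈ S := Finset.mem_filter.mpr ⟨Nat.one_mem_divisors.mpr hN0, by exact_mod_cast hy⟩
  have hSne : S.Nonempty := ⟨1, h1S⟩
  set f := S.max' hSne with hf
  have hfS : f ∈ S := Finset.max'_mem S hSne
  obtain ⟨hfd, hfy⟩ := Finset.mem_filter.mp hfS
  have hfN : f ∣ N := Nat.dvd_of_mem_divisors hfd
  refine ⟨f, hfN, ?_, hfy⟩
  by_contra hle
  push Not at hle
  -- `N / f > 1` has a prime factor `p ≤ z`, and `f p` is a larger admissible divisor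
  have hf0 : 0 < f := Nat.pos_of_mem_divisors hfd
  have hfltN : f < N := by exact_mod_cast hfy.trans_lt hyN
  set g := N / f with hg
  have hfg : f * g = N := Nat.mul_div_cancel' hfN
  have hg1 : g ≠ 1 := by
    intro h1
    rw [h1, mul_one] at hfg
    omega
  obtain ⟨p, hp, hpg⟩ := Nat.exists_prime_and_dvd hg1
  have hpN : p ∣ N := hpg.trans (Dvd.intro_left _ hfg)
  have hpz : (p : ℝ) ≤ z := by
    have := (Nat.mem_smoothNumbers'.mp hN) p hp hpN
    exact (lt_floor_add_one_iff hz.le p).mp this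
  have hfpN : f * p ∣ N := by
    rw [← hfg]
    exact Nat.mul_dvd_mul_left f hpg
  have hfpy : ((f * p : ℕ) : ℝ) ≤ y := by
    push_cast
    calc (f : ℝ) * p ≤ y / z * z := by
          gcongr
      _ = y := div_mul_cancel₀ y hz.ne'
  have hfpS : f * p ∈ S :=
    Finset.mem_filter.mpr ⟨Nat.mem_divisors.mpr ⟨hfpN, hN0⟩, hfpy⟩
  have hle' : f * p ≤ f := Finset.le_max' S _ hfpS
  have hp2 : 2 ≤ p := hp.two_le
  nlinarith

/-- **Lemma 3.1 (i) for a smooth number** (the iteration of the greedy step): for `y > z > 1`,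
every `z`-smooth `N` factors as `N = n₁ ⋯ n_m` with `1 < n_i ≤ y`, and — all factors but at most
one exceeding `y/z` — `(y/z)^m ≤ N · (y/z)`. [cite: TaoTeravainen2021, Lemma 3.1 (i) and its proof] -/
theorem exists_factorization_smooth {y z : ℝ} (hz : 1 < z) (hzy : z < y) :
    ∀ N : ℕ, N ∈ Nat.smoothNumbers (⌊z⌋₊ + 1) →
      ∃ l : List ℕ, l.prod = N ∧ (∀ a ∈ l, 1 < a ∧ (a : ℝ) ≤ y ∧ a ∣ N) ∧
        (y / z) ^ l.length ≤ (N : ℝ) * (y / z) := by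
  have hz0 : 0 < z := by linarith
  have hy1 : 1 ≤ y := by linarith
  have hyz : 1 < y / z := (one_lt_div hz0).mpr hzy
  intro N
  induction N using Nat.strong_induction_on with
  | _ N ih =>
    intro hN
    have hN0 : N ≠ 0 := Nat.ne_zero_of_mem_smoothNumbers hN
    by_cases h1 : N = 1
    · subst h1
      refine ⟨[], by simp, by simp, ?_⟩
      simp only [List.length_nil, pow_zero, Nat.cast_one, one_mul]
      exact hyz.le
    by_cases hy : (N : ℝ) ≤ y
    · refine ⟨[N], by simp, fun a ha => ?_, ?_⟩
      · rw [List.mem_singleton] at ha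
        subst ha
        exact ⟨by omega, hy, dvd_rfl⟩
      · simp only [List.length_singleton, pow_one]
        have : (1 : ℝ) ≤ N := by exact_mod_cast Nat.pos_of_ne_zero hN0
        exact le_mul_of_one_le_left (by positivity) this
    · push Not at hy
      obtain ⟨f, hfN, hfl, hfy⟩ := exists_dvd_lt_le hz0 hy1 hN hy
      have hf1 : 1 < f := by exact_mod_cast hyz.trans hfl
      have hlt : N / f < N := Nat.div_lt_self (Nat.pos_of_ne_zero hN0) hf1
      have hdvd : N / f ∣ N := Nat.div_dvd_of_dvd hfN
      have hsm : N / f ∈ Nat.smoothNumbers (⌊z⌋₊ + 1) := Nat.mem_smoothNumbers_of_dvd hN hdvd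
      obtain ⟨l, hlprod, hlmem, hllen⟩ := ih (N / f) hlt hsm
      refine ⟨f :: l, ?_, ?_, ?_⟩
      · rw [List.prod_cons, hlprod]
        exact Nat.mul_div_cancel' hfN
      · intro a ha
        rw [List.mem_cons] at ha
        rcases ha with rfl | ha
        · exact ⟨hf1, hfy, hfN⟩
        · obtain ⟨h1a, hay, had⟩ := hlmem a ha
          exact ⟨h1a, hay, had.trans hdvd⟩
      · rw [List.length_cons, pow_succ]
        have hcast : (((N / f : ℕ) : ℝ)) * f = N := by
          rw [← Nat.cast_mul, Nat.div_mul_cancel hfN]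
        have h0 : (0 : ℝ) ≤ ((N / f : ℕ) : ℝ) * (y / z) := by positivity
        calc (y / z) ^ l.length * (y / z) ≤ ((N / f : ℕ) : ℝ) * (y / z) * (y / z) := by
              gcongr
          _ ≤ ((N / f : ℕ) : ℝ) * (y / z) * f := by gcongr
          _ = (N : ℝ) * (y / z) := by rw [mul_right_comm, hcast]

/-- **Tao–Teräväinen 2022, Lemma 3.1 (i) (Landreau)**: "If `n` is a natural number and
`y > z > 1`, then we can factor `n = n_(>z) n₁ ⋯ n_m` where `n₁, …, n_m ≤ y` lie in `ℕ_(≤z)` and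
`0 ≤ m ≤ 1 + log_{y/z} n`." Here `n₁ ⋯ n_m = n_(≤z)` = `smoothPart (⌊z⌋₊ + 1) n` (so that
`n = n_(>z) n₁ ⋯ n_m` by `smoothPart_mul_div`), the `n_i` are listed with `1 < n_i ≤ y`,
`n_i ∣ n`, `n_i` `z`-smooth; the companion statement "`n_(>z)` is the product of at most `log_z n`
primes" is `cardFactors_div_smoothPart_le`. [cite: TaoTeravainen2021, Lemma 3.1 (i)] -/
theorem exists_factorization {y z : ℝ} (hz : 1 < z) (hzy : z < y) {n : ℕ} (hn : n ≠ 0) :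
    ∃ l : List ℕ, l.prod = smoothPart (⌊z⌋₊ + 1) n ∧
      (∀ a ∈ l, 1 < a ∧ (a : ℝ) ≤ y ∧ a ∣ n ∧ a ∈ Nat.smoothNumbers (⌊z⌋₊ + 1)) ∧
      (l.length : ℝ) ≤ 1 + Real.log n / Real.log (y / z) := by
  have hz0 : 0 < z := by linarith
  have hyz : 1 < y / z := (one_lt_div hz0).mpr hzy
  have hlog : 0 < Real.log (y / z) := Real.log_pos hyz
  set N := smoothPart (⌊z⌋₊ + 1) n with hNdef
  have hN : N ∈ Nat.smoothNumbers (⌊z⌋₊ + 1) := smoothPart_mem_smoothNumbers _ n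
  obtain ⟨l, hlprod, hlmem, hllen⟩ := exists_factorization_smooth hz hzy N hN
  refine ⟨l, hlprod, fun a ha => ?_, ?_⟩
  · obtain ⟨h1a, hay, haN⟩ := hlmem a ha
    exact ⟨h1a, hay, haN.trans (smoothPart_dvd hn _), Nat.mem_smoothNumbers_of_dvd hN haN⟩
  · have hn0 : (0 : ℝ) < n := by exact_mod_cast Nat.pos_of_ne_zero hn
    have hNn : (N : ℝ) ≤ n := by
      exact_mod_cast Nat.le_of_dvd (Nat.pos_of_ne_zero hn) (smoothPart_dvd hn _)
    have h1 : (y / z) ^ l.length ≤ (n : ℝ) * (y / z) :=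
      hllen.trans (mul_le_mul_of_nonneg_right hNn (by positivity))
    have h2 : (l.length : ℝ) * Real.log (y / z) ≤ Real.log n + Real.log (y / z) := by
      rw [← Real.log_pow, ← Real.log_mul hn0.ne' (by positivity)]
      exact Real.log_le_log (pow_pos (by positivity) _) h1
    have h3 : (l.length : ℝ) ≤ (Real.log n + Real.log (y / z)) / Real.log (y / z) :=
      (le_div_iff₀ hlog).mpr h2
    rw [add_div, div_self hlog.ne'] at h3
    linarith

/-! ### Lemma 3.1 (ii) -/

/-- `τ(ab) ≤ τ(a) τ(b)` ("the elementary inequality" of the proof of Lemma 3.1 (ii); also the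
tree's `Vaughan.card_divisors_mul_le`). [folklore] -/
private theorem card_divisors_mul_le (a b : ℕ) : (a * b).divisors.card ≤ a.divisors.card * b.divisors.card := by
  rw [Nat.divisors_mul]
  exact Finset.card_mul_le

/-- `τ(n₁ ⋯ n_m) ≤ B^m` if each `τ(n_i) ≤ B`. [folklore] -/
theorem card_divisors_prod_le_pow {B : ℕ} :
    ∀ l : List ℕ, (∀ a ∈ l, a.divisors.card ≤ B) → l.prod.divisors.card ≤ B ^ l.length
  | [], _ => by simp
  | a :: l, h => by
    rw [List.prod_cons, List.length_cons, pow_succ']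
    exact (card_divisors_mul_le a l.prod).trans
      (Nat.mul_le_mul (h a (by simp)) (card_divisors_prod_le_pow l fun b hb => h b (by simp [hb])))

/-- `τ(m) ≤ 2^{Ω(m)}` for `m ≠ 0` (`e + 1 ≤ 2^e` at each prime power; also the tree's
`BombieriSieve.card_divisors_le_two_pow_cardFactors`). [folklore] -/
private theorem card_divisors_le_two_pow_cardFactors {m : ℕ} (hm : m ≠ 0) : m.divisors.card ≤ 2 ^ Ω m := by
  rw [Nat.card_divisors hm, ArithmeticFunction.cardFactors_apply,
    ← List.sum_toFinset_count_eq_length, ← Finset.prod_pow_eq_pow_sum]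
  have hset : m.primeFactorsList.toFinset = m.primeFactors := rfl
  rw [hset]
  refine Finset.prod_le_prod' fun p _ => ?_
  rw [Nat.primeFactorsList_count_eq]
  exact Nat.succ_le_of_lt Nat.lt_two_pow_self

/-- **Tao–Teräväinen 2022, Lemma 3.1 (ii) (Landreau's inequality)**: "If `ε > 0`, then
`τ(n) ≪_ε ∑_{d ∣ n : d ≤ n^ε} τ(d)^{O_ε(1)}` for all `n ≥ 1`", with the admissible constants of the
printed proof made explicit — `C = 2^{2/ε}` (from `τ(n_(>z)) ≤ 2^{Ω(n_(>z))}`, `Ω ≤ log_z n = 2/ε`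
at `z = n^{ε/2}`) and exponent `M = ⌊1 + 2/ε⌋₊` (`m ≤ 1 + log_{y/z} n = 1 + 2/ε` at `y = n^ε`) —
and the cutoff `n^ε` relaxed to any `y ≥ n^ε` (the sum only grows):
`τ(n) ≤ C ∑_{d ∣ n, d ≤ y} τ(d)^M`. [cite: TaoTeravainen2021, Lemma 3.1 (ii)] [cite: Landreau1989] -/
theorem card_divisors_le_sum {ε : ℝ} (hε : 0 < ε) :
    ∃ C : ℝ, 0 < C ∧ ∃ M : ℕ, ∀ n : ℕ, n ≠ 0 → ∀ y : ℝ, (n : ℝ) ^ ε ≤ y →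
      (n.divisors.card : ℝ) ≤
        C * ∑ d ∈ n.divisors, if (d : ℝ) ≤ y then ((d.divisors.card : ℕ) : ℝ) ^ M else 0 := by
  refine ⟨(2 : ℝ) ^ (2 / ε), by positivity, ⌊1 + 2 / ε⌋₊, fun n hn y hy => ?_⟩
  set C : ℝ := (2 : ℝ) ^ (2 / ε) with hC
  set M : ℕ := ⌊1 + 2 / ε⌋₊ with hM
  have hC1 : 1 ≤ C := Real.one_le_rpow one_le_two (by positivity)
  have hn0 : (0 : ℝ) < n := by exact_mod_cast Nat.pos_of_ne_zero hn
  -- the summands are non-negative, and the `d = 1` summand is `1`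
  have hterm_nonneg : ∀ d ∈ n.divisors,
      (0 : ℝ) ≤ if (d : ℝ) ≤ y then ((d.divisors.card : ℕ) : ℝ) ^ M else 0 := by
    intro d _
    split_ifs <;> positivity
  have hy1 : (1 : ℝ) ≤ y := (Real.one_le_rpow (by exact_mod_cast Nat.pos_of_ne_zero hn) hε.le).trans hy
  -- a single admissible divisor `a ∣ n`, `a ≤ y`, contributes `τ(a)^M` to the sum
  have hsingle : ∀ a : ℕ, a ∣ n → (a : ℝ) ≤ y →
      ((a.divisors.card : ℕ) : ℝ) ^ M ≤
        ∑ d ∈ n.divisors, if (d : ℝ) ≤ y then ((d.divisors.card : ℕ) : ℝ) ^ M else 0 := by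
    intro a ha hay
    have hmem : a ∈ n.divisors := Nat.mem_divisors.mpr ⟨ha, hn⟩
    have := Finset.single_le_sum hterm_nonneg hmem
    simpa [hay] using this
  rcases Nat.lt_or_ge 1 n with h1n | hn1
  · -- `n ≥ 2`: Lemma 3.1 (i) with `y₀ = n^ε`, `z = n^{ε/2}`
    have hn1 : (1 : ℝ) < n := by exact_mod_cast h1n
    have hlogn : 0 < Real.log n := Real.log_pos hn1
    set z : ℝ := (n : ℝ) ^ (ε / 2) with hz
    set y₀ : ℝ := (n : ℝ) ^ ε with hy₀
    have hz1 : 1 < z := Real.one_lt_rpow hn1 (by positivity)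
    have hz0 : 0 < z := by linarith
    have hzy : z < y₀ := Real.rpow_lt_rpow_of_exponent_lt hn1 (by linarith)
    have hlogz : Real.log z = ε / 2 * Real.log n := Real.log_rpow hn0 _
    have hyz : y₀ / z = z := by
      rw [hy₀, hz, ← Real.rpow_sub hn0]
      congr 1
      ring
    obtain ⟨l, hlprod, hlmem, hllen⟩ := exists_factorization hz1 hzy hn
    set k := ⌊z⌋₊ + 1 with hk
    -- `τ(n) = τ(n_(≤z)) τ(n_(>z))`
    have hsplit : n.divisors.card =
        (smoothPart k n).divisors.card * (n / smoothPart k n).divisors.card := by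
      conv_lhs => rw [← smoothPart_mul_div hn k]
      exact Nat.Coprime.card_divisors_mul (coprime_smoothPart_div hn)
    -- `τ(n_(>z)) ≤ 2^{Ω} ≤ 2^{2/ε} = C`
    have hrough : ((n / smoothPart k n).divisors.card : ℝ) ≤ C := by
      have h1 : ((n / smoothPart k n).divisors.card : ℝ) ≤
          (2 : ℝ) ^ (Ω (n / smoothPart k n) : ℝ) := by
        rw [Real.rpow_natCast]
        exact_mod_cast card_divisors_le_two_pow_cardFactors (m := n / smoothPart k n)
          fun h0 => hn (by rw [← smoothPart_mul_div hn k, h0, mul_zero])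
      have h2 : (Ω (n / smoothPart k n) : ℝ) ≤ 2 / ε := by
        have := cardFactors_div_smoothPart_le hz1 hn
        rw [hlogz] at this
        calc (Ω (n / smoothPart (⌊z⌋₊ + 1) n) : ℝ) ≤ Real.log n / (ε / 2 * Real.log n) := this
          _ = 2 / ε := by field_simp
      exact h1.trans (Real.rpow_le_rpow_of_exponent_le one_le_two h2)
    -- `τ(n_(≤z)) ≤ τ(a)^M` for the factor `a` of the Landreau factorisation with the most divisors
    have hsmooth : ((smoothPart k n).divisors.card : ℝ) ≤
        ∑ d ∈ n.divisors, if (d : ℝ) ≤ y then ((d.divisors.card : ℕ) : ℝ) ^ M else 0 := by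
      have hmM : l.length ≤ M := by
        rw [hM]
        refine Nat.le_floor ?_
        have : Real.log n / Real.log (y₀ / z) = 2 / ε := by
          rw [hyz, hlogz]
          field_simp
        rw [this] at hllen
        exact_mod_cast hllen
      rcases l with _ | ⟨a, l'⟩
      · -- no factors: `n_(≤z) = 1`
        rw [List.prod_nil] at hlprod
        rw [← hlprod]
        have := hsingle 1 (one_dvd n) (by exact_mod_cast hy1)
        simpa using this
      · classical
        set L := a :: l' with hL
        have hLne : L.toFinset.Nonempty := ⟨a, by simp [hL]⟩
        obtain ⟨b, hbL, hbmax⟩ := Finset.exists_max_image L.toFinset (fun c => c.divisors.card) hLne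
        rw [List.mem_toFinset] at hbL
        obtain ⟨hb1, hby, hbn, -⟩ := hlmem b hbL
        have hB : ∀ c ∈ L, c.divisors.card ≤ b.divisors.card := fun c hc =>
          hbmax c (List.mem_toFinset.mpr hc)
        have hτb : 0 < b.divisors.card :=
          Finset.card_pos.mpr ⟨1, Nat.one_mem_divisors.mpr (by omega)⟩
        have h1 : (smoothPart k n).divisors.card ≤ b.divisors.card ^ M := by
          rw [← hlprod]
          exact (card_divisors_prod_le_pow L hB).trans (Nat.pow_le_pow_right hτb hmM)
        calc ((smoothPart k n).divisors.card : ℝ) ≤ ((b.divisors.card ^ M : ℕ) : ℝ) := by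
              exact_mod_cast h1
          _ = ((b.divisors.card : ℕ) : ℝ) ^ M := by push_cast; ring
          _ ≤ _ := hsingle b hbn (hby.trans hy)
    calc (n.divisors.card : ℝ)
        = ((smoothPart k n).divisors.card : ℝ) * ((n / smoothPart k n).divisors.card : ℝ) := by
          rw [hsplit, Nat.cast_mul]
      _ ≤ (∑ d ∈ n.divisors, if (d : ℝ) ≤ y then ((d.divisors.card : ℕ) : ℝ) ^ M else 0) * C :=
          mul_le_mul hsmooth hrough (by positivity) (Finset.sum_nonneg hterm_nonneg)
      _ = _ := mul_comm _ _
  · -- `n = 1`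
    have hn1' : n = 1 := by omega
    subst hn1'
    have := hsingle 1 (one_dvd 1) (by exact_mod_cast hy1)
    simp only [Nat.divisors_one, Finset.card_singleton, Nat.cast_one, one_pow] at this ⊢
    calc (1 : ℝ) ≤ 1 * 1 := by norm_num
      _ ≤ C * _ := mul_le_mul hC1 this zero_le_one (by linarith)

/-- **Lemma 3.1 (ii) in the form (3.10) used in the source** ("`τ(n) ≪ ∑_{d ∣ n : d ≤ D} τ(d)^{O(1)}`
for `n ≪ x`", `D` a fixed power of `x`): for `ε > 0` there are `C > 0` and `M` with
`τ(n) ≤ C ∑_{d ∣ n, d ≤ X^ε} τ(d)^M` whenever `1 ≤ n ≤ X`. [cite: TaoTeravainen2021, Lemma 3.1 (ii), (3.10)] -/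
theorem card_divisors_le_sum_of_le {ε : ℝ} (hε : 0 < ε) :
    ∃ C : ℝ, 0 < C ∧ ∃ M : ℕ, ∀ (X : ℝ) (n : ℕ), n ≠ 0 → (n : ℝ) ≤ X →
      (n.divisors.card : ℝ) ≤
        C * ∑ d ∈ n.divisors, if (d : ℝ) ≤ X ^ ε then ((d.divisors.card : ℕ) : ℝ) ^ M else 0 := by
  obtain ⟨C, hC, M, h⟩ := card_divisors_le_sum hε
  refine ⟨C, hC, M, fun X n hn hnX => h n hn _ ?_⟩
  exact Real.rpow_le_rpow (Nat.cast_nonneg n) hnX hε.le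

end Landreau

end Literature.NumberTheory.Sieve
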